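import Summits.Ventures.CertifiedManyBodySolver.Certificates.HubbardSquare_n9o8_tpm1o4_thermal_axis_PH_C2markov3x3_j273931
import Literature.MathematicalPhysics.QuantumLattice.TypeClassSidecarReaderUBox
import Literature.MathematicalPhysics.QuantumLattice.TypeClassSidecarReaderAllTori
import HarnessLib

/-!
# Ventures/CertifiedManyBodySolver — ELECTRON-DOPED `U`-SEGMENT cells: `(n, t′) = (9/8, −1/4)`, EVERY `0 ≤ U ≤ 8`, `β ∈ {1/2, …, 3}` and colder,
# by PARTICLE–HOLE from the C2-ONLY image caps of hubbard-thermal-p2's `t' = +1/4` sidecars (kit j273931) read DOWN in `U` (hubbard-downfold-unc-1's reader)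

HONEST FRAMING: first certified bounds; not a superconductivity verdict; every number certified or labelled float.
WHAT THIS IS NOT: not a phase sentence; not of record until the mbsolver LEAD pen + referee sign; energy WINDOWS for the tree's THERMAL object of the
ELECTRON-DOPED `t–t'` model — torus limits of the canonical sector Gibbs states of `hubbardTorusTT' L 1 (-1/4) U` on `N↑ = N↓ = ⌊9L²/16⌋`, `0 ≤ U ≤ 8` —
along `Ls → ∞` with `4 ∣ Ls j` eventually (flag «PH-transported, even-tori subsequence», cell ruling R-co 2026-08-27); the UPPER edges are CONDITIONAL on
p2's C2 «sector» sidecar nodes `cert_c2sector_tp1o4_3x3_<β>_j273931` (NO C1 certificate is used: C2-only caps against the exact `β = 0` anchor), the LOWER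
edges are kernel theorems (Fermi-sea tangent row at the image point + particle–hole, `ground_n9o8_tpm1o4_floor_PH`); no new certificate; 0 core-h.

WHY (the NCCO #20 box of the router, `router/BOXES/Nd2CuO4-NCCO.md`: `U/t ∈ [2.4, 8.23]`, `t'/t ∈ [−0.29, −0.19] ∋ −1/4`, `n ∈ [1.09, 1.17] ∋ 9/8`): the companion
file `…_thermal_axis_PH_C2markov3x3_j273931` words the corner `U = 8` with p2's C1+C2 caps; this file words the whole `U`-segment `[0, 8] ∋ [2.4, 8]` of the box
at its central `(n, t′)`. MECHANISM: (i) hubbard-downfold-unc-1's `U`-leg reader `IsTorusLimitOfMixture.meanEnergy_hubbardTTPrime_le_of_c2Check_infT_seven_eighths_of_le_U`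
(open-box partition functions are antitone in `U`, the `β = 0` anchor is `U`-free): p2's sidecar at `U₀ = 8` gives, for EVERY `U ≤ 8`, the image-point cap
`e_{Φ(1,1/4,U)}(ω') ≤ (1.371 − W_β)/β =: k_β` over the canonical class at `(1, 1/4, U, 7/8, β)` (every `Ls'`), hence at every colder `β' ≥ β`
(`…le_of_forall_at_hotter_allTori`); (ii) this seat's particle–hole transport (`IsTorusLimitOfMixture.forall_particleHole_of_sectorGibbs`,
`…meanEnergy_particleHole_hubbardTTPrime_of_sectorGibbs`): `e_{Φ(1,−1/4,U)}(ω) = e_{Φ(1,1/4,U)}(ω ∘ α) + U·(9/8 − 1) ≤ k_β + U/8` over the electron-doped class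
along `4 ∣ L`; (iii) LOWER edge `−1.7034878090 + U/8 ≤ e(1,−1/4,U,9/8) ≤ e(ω)` for every `U ≥ 0`, every `β`, every `Ls` (kernel, no node).
HENCE, 10-dp outward, for every torus limit at `β' ≥ β` and every `0 ≤ U ≤ 8`:
  `β = 1/2` (T = 2t): `e ∈ [−1.7034878090 + U/8, 0.5106706185 + U/8]` (at `U = 8`: `[−0.7034878090, 1.5106706185]`; the C1+C2 corner cap of the companion file is tighter at `U = 8`) ·
  `β = 3/4` (T = 4t/3): `e ∈ [−1.7034878090 + U/8, 0.2616228854 + U/8]` (at `U = 8`: `[−0.7034878090, 1.2616228854]`; the C1+C2 corner cap of the companion file is tighter at `U = 8`) ·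
  `β = 1` (T = t): `e ∈ [−1.7034878090 + U/8, 0.1080611663 + U/8]` (at `U = 8`: `[−0.7034878090, 1.1080611663]`; the C1+C2 corner cap of the companion file is tighter at `U = 8`) ·
  `β = 5/4` (T = 4t/5): `e ∈ [−1.7034878090 + U/8, 0.0052677959 + U/8]` (at `U = 8`: `[−0.7034878090, 1.0052677959]`; the C1+C2 corner cap of the companion file is tighter at `U = 8`) ·
  `β = 3/2` (T = 2t/3): `e ∈ [−1.7034878090 + U/8, -0.0688291288 + U/8]` (at `U = 8`: `[−0.7034878090, 0.9311708712]`; the C1+C2 corner cap of the companion file is tighter at `U = 8`) ·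
  `β = 2` (T = t/2): `e ∈ [−1.7034878090 + U/8, -0.1701056955 + U/8]` (at `U = 8`: `[−0.7034878090, 0.8298943045]`; the C1+C2 corner cap of the companion file is tighter at `U = 8`) ·
  `β = 3` (T = t/3): `e ∈ [−1.7034878090 + U/8, -0.2862113870 + U/8]` (at `U = 8`: `[−0.7034878090, 0.7137886130]`; the C1+C2 corner cap of the companion file is tighter at `U = 8`).
HONEST LIMITS: C2-only caps are `0.07–0.17·t` looser than p2's C1+C2 caps at `U = 8` but need no C1 node and hold on the whole segment; the box sliver `U ∈ (8, 8.23]`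
is NOT covered here (above `U₀` the floor side pays `β(U − U₀)·D` — unc-1's `…_of_doccWord_left_U` readers; not done); `(n, t′)` is one point of the box, not its
`n`/`t′` faces. Strength (upper edges) = the named C2 nodes ∧ kernel theorems; retracted with any of them.
[cite: LiebWuPhysicaA2003, §1 eq. (3)] [cite: Israel1979, Lemma II.3.1] [cite: Israel1979, Thm. I.3.4] [cite: Ruelle1969, §3.3] [cite: CoverThomas2006, Theorem 11.1.3]
[cite: LiebLoss1993, §8, Theorem 8.2]
Seat prover-hubbard-downfold-unc-2-g8, 2026-08-27; zero solves, zero kit.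
-/

noncomputable section

namespace Summit.Ventures.CertifiedManyBodySolver.Certificates

open Literature.MathematicalPhysics.QuantumLattice
open Literature.MathematicalPhysics.QuantumLattice.ThermodynamicLimit
open Literature.MathematicalPhysics.QuantumLattice.InfVolFermionState
open Literature.MathematicalPhysics.QuantumLattice.AndersonCluster
open Literature.Probability.LatticeModels
open _root_.Filter
open scoped ComplexOrder

/-- **The transport step at general `U`**: an image-point cap `e_{Φ(1,1/4,U)} ≤ c` over the canonical class at `(1, 1/4, U, 7/8, β)` (every `Ls' → ∞`)
gives `e_{Φ(1,-1/4,U)}(ω) ≤ c + U/8` for every torus limit `ω` of the canonical class at `(1, -1/4, U, 9/8, β)` along `Ls → ∞` with `4 ∣ Ls j` eventually.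
[cite: LiebWuPhysicaA2003, §1 eq. (3)] -/
theorem thermal_n9o8_tpm1o4_upper_of_image_cap_U {β U c : ℝ}
    (hcap : ∀ (Ls' : ℕ → ℕ) (ω' : InfVolFermionState 2), Tendsto Ls' atTop atTop →
      ω'.IsTorusLimitOfMixture (sectorGibbsCount (7 / 8)) (fun L => sectorGibbsWeightTT' β 1 (1 / 4) U (7 / 8) L)
        (fun L => sectorGibbsVectorTT' 1 (1 / 4) U (7 / 8) L) Ls' →
      ω'.meanEnergy (hubbardTTPrimeFermionInteraction 1 (1 / 4) U) 1 ≤ c)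
    {ω : InfVolFermionState 2} {Ls : ℕ → ℕ} (hLs : Tendsto Ls atTop atTop) (h4 : ∀ᶠ j in atTop, 4 ∣ Ls j)
    (h : ω.IsTorusLimitOfMixture (sectorGibbsCount (9 / 8)) (fun L => sectorGibbsWeightTT' β 1 (-1 / 4) U (9 / 8) L)
      (fun L => sectorGibbsVectorTT' 1 (-1 / 4) U (9 / 8) L) Ls) :
    ω.meanEnergy (hubbardTTPrimeFermionInteraction 1 (-1 / 4) U) 1 ≤ c + U * (1 / 8) := by
  have heven : ∀ᶠ j in atTop, Even (Ls j) :=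
    h4.mono fun j hj => even_iff_two_dvd.2 (dvd_trans (by norm_num) hj)
  have hadd : ∀ᶠ j in atTop, halfRectN (2 - 9 / 8) (Ls j) + halfRectN (9 / 8) (Ls j) = Ls j ^ 2 :=
    h4.mono fun j hj => halfRectN_compl_nine_eighths hj
  have himg : ω.particleHole.meanEnergy (hubbardTTPrimeFermionInteraction 1 (1 / 4) U) 1 ≤ c := by
    refine IsTorusLimitOfMixture.forall_particleHole_of_sectorGibbs β 1 (-1 / 4) U (9 / 8)
      (P := fun ω' => ω'.meanEnergy (hubbardTTPrimeFermionInteraction 1 (1 / 4) U) 1 ≤ c) ?_ hLs heven hadd h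
    intro Ls' ω' hLs' hω'
    have e1 : (-(-1 / 4) : ℝ) = 1 / 4 := by norm_num
    have e2 : (2 - 9 / 8 : ℝ) = 7 / 8 := by norm_num
    rw [e1, e2] at hω'
    exact hcap Ls' ω' hLs' hω'
  have hid := h.meanEnergy_particleHole_hubbardTTPrime_of_sectorGibbs β 1 (-1 / 4) U (n := 9 / 8) (by norm_num) (by norm_num)
    hLs heven 1 (1 / 4) U
  have e3 : (-(1 / 4) : ℝ) = -1 / 4 := by norm_num
  rw [e3] at hid
  rw [hid] at himg
  linarith

/-- **LOWER EDGE at every `U ≥ 0`** (every `β`, every `Ls`, no node): `−1.7034878090 + U/8 ≤ e(ω)` for every torus limit of the canonical class at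
`(1, −1/4, U, 9/8, β)` (thermal ≥ ground ≥ particle–hole Fermi-sea floor `ground_n9o8_tpm1o4_floor_PH`). [cite: Ruelle1969, §3.4] [cite: LiebLoss1993, §8, Theorem 8.2] -/
theorem thermal_n9o8_tpm1o4_lower_U {β U : ℝ} (hU : 0 ≤ U) {ω : InfVolFermionState 2} {Ls : ℕ → ℕ} (hLs : Tendsto Ls atTop atTop)
    (h : ω.IsTorusLimitOfMixture (sectorGibbsCount (9 / 8)) (fun L => sectorGibbsWeightTT' β 1 (-1 / 4) U (9 / 8) L)
      (fun L => sectorGibbsVectorTT' 1 (-1 / 4) U (9 / 8) L) Ls) :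
    (-1.7034878090 : ℝ) + U * (1 / 8) ≤ ω.meanEnergy (hubbardTTPrimeFermionInteraction 1 (-1 / 4) U) 1 :=
  (ground_n9o8_tpm1o4_floor_PH hU).trans
    (h.energyDensityTT'_le_meanEnergy_of_sectorGibbs 1 (-1 / 4) U (n := 9 / 8) (by norm_num) (by norm_num) β hLs (-1 / 4) hU)

/-- **Image-point C2-ONLY cap at `β = 1/2`, EVERY `U ≤ 8`, every colder `β' ≥ 1/2`** (hole side `(1, 1/4, U, 7/8)`, every `Ls'`): `e ≤ 0.5106706185`
(`= (1.371 − W)/β` outward, `W = 153335787527/137438953472` of `c2Check_tp1o4_3x3_b1o2_j273931`; the sidecar sits at `U₀ = 8` and reads DOWN in `U` —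
hubbard-downfold-unc-1's `…le_of_c2Check_infT_seven_eighths_of_le_U`; colder by `…le_of_forall_at_hotter_allTori`). Strength = C2(cert_c2sector_tp1o4_3x3_b1o2_j273931) ∧ kernel theorems.
[cite: Israel1979, Thm. I.3.4] [cite: CoverThomas2006, Theorem 11.1.3] [cite: Ruelle1969, §2.5–2.6] -/
theorem image_n7o8_tp1o4_upper_b1o2_C2only_of_U_le (hC2 : cert_c2sector_tp1o4_3x3_b1o2_j273931) {U : ℝ} (hU8 : U ≤ 8)
    {β : ℝ} (hle : (1 / 2 : ℝ) ≤ β) {ω : InfVolFermionState 2} {Ls : ℕ → ℕ} (hLs : Tendsto Ls atTop atTop)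
    (h : ω.IsTorusLimitOfMixture (sectorGibbsCount (7 / 8)) (fun L => sectorGibbsWeightTT' β 1 (1 / 4) U (7 / 8) L)
      (fun L => sectorGibbsVectorTT' 1 (1 / 4) U (7 / 8) L) Ls) :
    ω.meanEnergy (hubbardTTPrimeFermionInteraction 1 (1 / 4) U) 1 ≤ (0.5106706185 : ℝ) := by
  refine IsTorusLimitOfMixture.meanEnergy_hubbardTTPrime_le_of_forall_at_hotter_allTori (t := 1) (t' := (1 / 4)) (U := U)
    (n := 7 / 8) (by norm_num) (by norm_num) (β₁ := (1 / 2 : ℝ)) (by norm_num) hle (fun ω₁ Ls₁ hLs₁ h₁ => ?_) hLs h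
  have hk := h₁.meanEnergy_hubbardTTPrime_le_of_c2Check_infT_seven_eighths_of_le_U (U₀ := 8) hU8 hLs₁ (by norm_num)
    (a := 3) (b := 3) (by norm_num) (by norm_num) c2Check_tp1o4_3x3_b1o2_j273931 (by norm_num) hC2
  exact hk.trans (by norm_num)

/-- **ELECTRON-DOPED cap, `β' ≥ 1/2`, EVERY `U ≤ 8`**: `e_{Φ(1,−1/4,U)}(ω) ≤ 0.5106706185 + U/8` for every torus limit of the canonical class at
`(1, −1/4, U, 9/8, β')` along `Ls` with `4 ∣ Ls j` eventually. Strength = C2(cert_c2sector_tp1o4_3x3_b1o2_j273931) ∧ kernel theorems.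
[cite: LiebWuPhysicaA2003, §1 eq. (3)] [cite: Israel1979, Thm. I.3.4] -/
theorem thermal_n9o8_tpm1o4_upper_b1o2_PH_C2only_of_U_le (hC2 : cert_c2sector_tp1o4_3x3_b1o2_j273931) {U : ℝ} (hU8 : U ≤ 8)
    {β : ℝ} (hle : (1 / 2 : ℝ) ≤ β) {ω : InfVolFermionState 2} {Ls : ℕ → ℕ} (hLs : Tendsto Ls atTop atTop) (h4 : ∀ᶠ j in atTop, 4 ∣ Ls j)
    (h : ω.IsTorusLimitOfMixture (sectorGibbsCount (9 / 8)) (fun L => sectorGibbsWeightTT' β 1 (-1 / 4) U (9 / 8) L)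
      (fun L => sectorGibbsVectorTT' 1 (-1 / 4) U (9 / 8) L) Ls) :
    ω.meanEnergy (hubbardTTPrimeFermionInteraction 1 (-1 / 4) U) 1 ≤ (0.5106706185 : ℝ) + U * (1 / 8) :=
  thermal_n9o8_tpm1o4_upper_of_image_cap_U
    (fun _ _ hLs' h' => image_n7o8_tp1o4_upper_b1o2_C2only_of_U_le hC2 hU8 hle hLs' h') hLs h4 h

/-- **ELECTRON-DOPED WINDOW, `β' ≥ 1/2`, EVERY `0 ≤ U ≤ 8`**: `e ∈ [−1.7034878090 + U/8, 0.5106706185 + U/8]`. Strength (upper edge) =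
C2(cert_c2sector_tp1o4_3x3_b1o2_j273931) ∧ kernel theorems; lower edge kernel. [cite: LiebWuPhysicaA2003, §1 eq. (3)] [cite: Ruelle1969, §3.4] -/
theorem thermal_n9o8_tpm1o4_window_b1o2_PH_C2only_of_U_le (hC2 : cert_c2sector_tp1o4_3x3_b1o2_j273931) {U : ℝ} (hU0 : 0 ≤ U) (hU8 : U ≤ 8)
    {β : ℝ} (hle : (1 / 2 : ℝ) ≤ β) {ω : InfVolFermionState 2} {Ls : ℕ → ℕ} (hLs : Tendsto Ls atTop atTop) (h4 : ∀ᶠ j in atTop, 4 ∣ Ls j)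
    (h : ω.IsTorusLimitOfMixture (sectorGibbsCount (9 / 8)) (fun L => sectorGibbsWeightTT' β 1 (-1 / 4) U (9 / 8) L)
      (fun L => sectorGibbsVectorTT' 1 (-1 / 4) U (9 / 8) L) Ls) :
    ω.meanEnergy (hubbardTTPrimeFermionInteraction 1 (-1 / 4) U) 1 ∈
      Set.Icc ((-1.7034878090 : ℝ) + U * (1 / 8)) ((0.5106706185 : ℝ) + U * (1 / 8)) :=
  ⟨thermal_n9o8_tpm1o4_lower_U hU0 hLs h, thermal_n9o8_tpm1o4_upper_b1o2_PH_C2only_of_U_le hC2 hU8 hle hLs h4 h⟩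

/-- **Image-point C2-ONLY cap at `β = 3/4`, EVERY `U ≤ 8`, every colder `β' ≥ 3/4`** (hole side `(1, 1/4, U, 7/8)`, every `Ls'`): `e ≤ 0.2616228854`
(`= (1.371 − W)/β` outward, `W = 1291687388303/1099511627776` of `c2Check_tp1o4_3x3_b3o4_j273931`; the sidecar sits at `U₀ = 8` and reads DOWN in `U` —
hubbard-downfold-unc-1's `…le_of_c2Check_infT_seven_eighths_of_le_U`; colder by `…le_of_forall_at_hotter_allTori`). Strength = C2(cert_c2sector_tp1o4_3x3_b3o4_j273931) ∧ kernel theorems.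
[cite: Israel1979, Thm. I.3.4] [cite: CoverThomas2006, Theorem 11.1.3] [cite: Ruelle1969, §2.5–2.6] -/
theorem image_n7o8_tp1o4_upper_b3o4_C2only_of_U_le (hC2 : cert_c2sector_tp1o4_3x3_b3o4_j273931) {U : ℝ} (hU8 : U ≤ 8)
    {β : ℝ} (hle : (3 / 4 : ℝ) ≤ β) {ω : InfVolFermionState 2} {Ls : ℕ → ℕ} (hLs : Tendsto Ls atTop atTop)
    (h : ω.IsTorusLimitOfMixture (sectorGibbsCount (7 / 8)) (fun L => sectorGibbsWeightTT' β 1 (1 / 4) U (7 / 8) L)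
      (fun L => sectorGibbsVectorTT' 1 (1 / 4) U (7 / 8) L) Ls) :
    ω.meanEnergy (hubbardTTPrimeFermionInteraction 1 (1 / 4) U) 1 ≤ (0.2616228854 : ℝ) := by
  refine IsTorusLimitOfMixture.meanEnergy_hubbardTTPrime_le_of_forall_at_hotter_allTori (t := 1) (t' := (1 / 4)) (U := U)
    (n := 7 / 8) (by norm_num) (by norm_num) (β₁ := (3 / 4 : ℝ)) (by norm_num) hle (fun ω₁ Ls₁ hLs₁ h₁ => ?_) hLs h
  have hk := h₁.meanEnergy_hubbardTTPrime_le_of_c2Check_infT_seven_eighths_of_le_U (U₀ := 8) hU8 hLs₁ (by norm_num)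
    (a := 3) (b := 3) (by norm_num) (by norm_num) c2Check_tp1o4_3x3_b3o4_j273931 (by norm_num) hC2
  exact hk.trans (by norm_num)

/-- **ELECTRON-DOPED cap, `β' ≥ 3/4`, EVERY `U ≤ 8`**: `e_{Φ(1,−1/4,U)}(ω) ≤ 0.2616228854 + U/8` for every torus limit of the canonical class at
`(1, −1/4, U, 9/8, β')` along `Ls` with `4 ∣ Ls j` eventually. Strength = C2(cert_c2sector_tp1o4_3x3_b3o4_j273931) ∧ kernel theorems.
[cite: LiebWuPhysicaA2003, §1 eq. (3)] [cite: Israel1979, Thm. I.3.4] -/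
theorem thermal_n9o8_tpm1o4_upper_b3o4_PH_C2only_of_U_le (hC2 : cert_c2sector_tp1o4_3x3_b3o4_j273931) {U : ℝ} (hU8 : U ≤ 8)
    {β : ℝ} (hle : (3 / 4 : ℝ) ≤ β) {ω : InfVolFermionState 2} {Ls : ℕ → ℕ} (hLs : Tendsto Ls atTop atTop) (h4 : ∀ᶠ j in atTop, 4 ∣ Ls j)
    (h : ω.IsTorusLimitOfMixture (sectorGibbsCount (9 / 8)) (fun L => sectorGibbsWeightTT' β 1 (-1 / 4) U (9 / 8) L)
      (fun L => sectorGibbsVectorTT' 1 (-1 / 4) U (9 / 8) L) Ls) :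
    ω.meanEnergy (hubbardTTPrimeFermionInteraction 1 (-1 / 4) U) 1 ≤ (0.2616228854 : ℝ) + U * (1 / 8) :=
  thermal_n9o8_tpm1o4_upper_of_image_cap_U
    (fun _ _ hLs' h' => image_n7o8_tp1o4_upper_b3o4_C2only_of_U_le hC2 hU8 hle hLs' h') hLs h4 h

/-- **ELECTRON-DOPED WINDOW, `β' ≥ 3/4`, EVERY `0 ≤ U ≤ 8`**: `e ∈ [−1.7034878090 + U/8, 0.2616228854 + U/8]`. Strength (upper edge) =
C2(cert_c2sector_tp1o4_3x3_b3o4_j273931) ∧ kernel theorems; lower edge kernel. [cite: LiebWuPhysicaA2003, §1 eq. (3)] [cite: Ruelle1969, §3.4] -/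
theorem thermal_n9o8_tpm1o4_window_b3o4_PH_C2only_of_U_le (hC2 : cert_c2sector_tp1o4_3x3_b3o4_j273931) {U : ℝ} (hU0 : 0 ≤ U) (hU8 : U ≤ 8)
    {β : ℝ} (hle : (3 / 4 : ℝ) ≤ β) {ω : InfVolFermionState 2} {Ls : ℕ → ℕ} (hLs : Tendsto Ls atTop atTop) (h4 : ∀ᶠ j in atTop, 4 ∣ Ls j)
    (h : ω.IsTorusLimitOfMixture (sectorGibbsCount (9 / 8)) (fun L => sectorGibbsWeightTT' β 1 (-1 / 4) U (9 / 8) L)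
      (fun L => sectorGibbsVectorTT' 1 (-1 / 4) U (9 / 8) L) Ls) :
    ω.meanEnergy (hubbardTTPrimeFermionInteraction 1 (-1 / 4) U) 1 ∈
      Set.Icc ((-1.7034878090 : ℝ) + U * (1 / 8)) ((0.2616228854 : ℝ) + U * (1 / 8)) :=
  ⟨thermal_n9o8_tpm1o4_lower_U hU0 hLs h, thermal_n9o8_tpm1o4_upper_b3o4_PH_C2only_of_U_le hC2 hU8 hle hLs h4 h⟩

/-- **Image-point C2-ONLY cap at `β = 1`, EVERY `U ≤ 8`, every colder `β' ≥ 1`** (hole side `(1, 1/4, U, 7/8)`, every `Ls'`): `e ≤ 0.1080611663`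
(`= (1.371 − W)/β` outward, `W = 694307966453/549755813888` of `c2Check_tp1o4_3x3_b1_j273931`; the sidecar sits at `U₀ = 8` and reads DOWN in `U` —
hubbard-downfold-unc-1's `…le_of_c2Check_infT_seven_eighths_of_le_U`; colder by `…le_of_forall_at_hotter_allTori`). Strength = C2(cert_c2sector_tp1o4_3x3_b1_j273931) ∧ kernel theorems.
[cite: Israel1979, Thm. I.3.4] [cite: CoverThomas2006, Theorem 11.1.3] [cite: Ruelle1969, §2.5–2.6] -/
theorem image_n7o8_tp1o4_upper_b1_C2only_of_U_le (hC2 : cert_c2sector_tp1o4_3x3_b1_j273931) {U : ℝ} (hU8 : U ≤ 8)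
    {β : ℝ} (hle : (1 : ℝ) ≤ β) {ω : InfVolFermionState 2} {Ls : ℕ → ℕ} (hLs : Tendsto Ls atTop atTop)
    (h : ω.IsTorusLimitOfMixture (sectorGibbsCount (7 / 8)) (fun L => sectorGibbsWeightTT' β 1 (1 / 4) U (7 / 8) L)
      (fun L => sectorGibbsVectorTT' 1 (1 / 4) U (7 / 8) L) Ls) :
    ω.meanEnergy (hubbardTTPrimeFermionInteraction 1 (1 / 4) U) 1 ≤ (0.1080611663 : ℝ) := by
  refine IsTorusLimitOfMixture.meanEnergy_hubbardTTPrime_le_of_forall_at_hotter_allTori (t := 1) (t' := (1 / 4)) (U := U)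
    (n := 7 / 8) (by norm_num) (by norm_num) (β₁ := (1 : ℝ)) (by norm_num) hle (fun ω₁ Ls₁ hLs₁ h₁ => ?_) hLs h
  have hk := h₁.meanEnergy_hubbardTTPrime_le_of_c2Check_infT_seven_eighths_of_le_U (U₀ := 8) hU8 hLs₁ (by norm_num)
    (a := 3) (b := 3) (by norm_num) (by norm_num) c2Check_tp1o4_3x3_b1_j273931 (by norm_num) hC2
  exact hk.trans (by norm_num)

/-- **ELECTRON-DOPED cap, `β' ≥ 1`, EVERY `U ≤ 8`**: `e_{Φ(1,−1/4,U)}(ω) ≤ 0.1080611663 + U/8` for every torus limit of the canonical class at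
`(1, −1/4, U, 9/8, β')` along `Ls` with `4 ∣ Ls j` eventually. Strength = C2(cert_c2sector_tp1o4_3x3_b1_j273931) ∧ kernel theorems.
[cite: LiebWuPhysicaA2003, §1 eq. (3)] [cite: Israel1979, Thm. I.3.4] -/
theorem thermal_n9o8_tpm1o4_upper_b1_PH_C2only_of_U_le (hC2 : cert_c2sector_tp1o4_3x3_b1_j273931) {U : ℝ} (hU8 : U ≤ 8)
    {β : ℝ} (hle : (1 : ℝ) ≤ β) {ω : InfVolFermionState 2} {Ls : ℕ → ℕ} (hLs : Tendsto Ls atTop atTop) (h4 : ∀ᶠ j in atTop, 4 ∣ Ls j)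
    (h : ω.IsTorusLimitOfMixture (sectorGibbsCount (9 / 8)) (fun L => sectorGibbsWeightTT' β 1 (-1 / 4) U (9 / 8) L)
      (fun L => sectorGibbsVectorTT' 1 (-1 / 4) U (9 / 8) L) Ls) :
    ω.meanEnergy (hubbardTTPrimeFermionInteraction 1 (-1 / 4) U) 1 ≤ (0.1080611663 : ℝ) + U * (1 / 8) :=
  thermal_n9o8_tpm1o4_upper_of_image_cap_U
    (fun _ _ hLs' h' => image_n7o8_tp1o4_upper_b1_C2only_of_U_le hC2 hU8 hle hLs' h') hLs h4 h

/-- **ELECTRON-DOPED WINDOW, `β' ≥ 1`, EVERY `0 ≤ U ≤ 8`**: `e ∈ [−1.7034878090 + U/8, 0.1080611663 + U/8]`. Strength (upper edge) =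
C2(cert_c2sector_tp1o4_3x3_b1_j273931) ∧ kernel theorems; lower edge kernel. [cite: LiebWuPhysicaA2003, §1 eq. (3)] [cite: Ruelle1969, §3.4] -/
theorem thermal_n9o8_tpm1o4_window_b1_PH_C2only_of_U_le (hC2 : cert_c2sector_tp1o4_3x3_b1_j273931) {U : ℝ} (hU0 : 0 ≤ U) (hU8 : U ≤ 8)
    {β : ℝ} (hle : (1 : ℝ) ≤ β) {ω : InfVolFermionState 2} {Ls : ℕ → ℕ} (hLs : Tendsto Ls atTop atTop) (h4 : ∀ᶠ j in atTop, 4 ∣ Ls j)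
    (h : ω.IsTorusLimitOfMixture (sectorGibbsCount (9 / 8)) (fun L => sectorGibbsWeightTT' β 1 (-1 / 4) U (9 / 8) L)
      (fun L => sectorGibbsVectorTT' 1 (-1 / 4) U (9 / 8) L) Ls) :
    ω.meanEnergy (hubbardTTPrimeFermionInteraction 1 (-1 / 4) U) 1 ∈
      Set.Icc ((-1.7034878090 : ℝ) + U * (1 / 8)) ((0.1080611663 : ℝ) + U * (1 / 8)) :=
  ⟨thermal_n9o8_tpm1o4_lower_U hU0 hLs h, thermal_n9o8_tpm1o4_upper_b1_PH_C2only_of_U_le hC2 hU8 hle hLs h4 h⟩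

/-- **Image-point C2-ONLY cap at `β = 5/4`, EVERY `U ≤ 8`, every colder `β' ≥ 5/4`** (hole side `(1, 1/4, U, 7/8)`, every `Ls'`): `e ≤ 0.0052677959`
(`= (1.371 − W)/β` outward, `W = 375047609549/274877906944` of `c2Check_tp1o4_3x3_b5o4_j273931`; the sidecar sits at `U₀ = 8` and reads DOWN in `U` —
hubbard-downfold-unc-1's `…le_of_c2Check_infT_seven_eighths_of_le_U`; colder by `…le_of_forall_at_hotter_allTori`). Strength = C2(cert_c2sector_tp1o4_3x3_b5o4_j273931) ∧ kernel theorems.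
[cite: Israel1979, Thm. I.3.4] [cite: CoverThomas2006, Theorem 11.1.3] [cite: Ruelle1969, §2.5–2.6] -/
theorem image_n7o8_tp1o4_upper_b5o4_C2only_of_U_le (hC2 : cert_c2sector_tp1o4_3x3_b5o4_j273931) {U : ℝ} (hU8 : U ≤ 8)
    {β : ℝ} (hle : (5 / 4 : ℝ) ≤ β) {ω : InfVolFermionState 2} {Ls : ℕ → ℕ} (hLs : Tendsto Ls atTop atTop)
    (h : ω.IsTorusLimitOfMixture (sectorGibbsCount (7 / 8)) (fun L => sectorGibbsWeightTT' β 1 (1 / 4) U (7 / 8) L)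
      (fun L => sectorGibbsVectorTT' 1 (1 / 4) U (7 / 8) L) Ls) :
    ω.meanEnergy (hubbardTTPrimeFermionInteraction 1 (1 / 4) U) 1 ≤ (0.0052677959 : ℝ) := by
  refine IsTorusLimitOfMixture.meanEnergy_hubbardTTPrime_le_of_forall_at_hotter_allTori (t := 1) (t' := (1 / 4)) (U := U)
    (n := 7 / 8) (by norm_num) (by norm_num) (β₁ := (5 / 4 : ℝ)) (by norm_num) hle (fun ω₁ Ls₁ hLs₁ h₁ => ?_) hLs h
  have hk := h₁.meanEnergy_hubbardTTPrime_le_of_c2Check_infT_seven_eighths_of_le_U (U₀ := 8) hU8 hLs₁ (by norm_num)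
    (a := 3) (b := 3) (by norm_num) (by norm_num) c2Check_tp1o4_3x3_b5o4_j273931 (by norm_num) hC2
  exact hk.trans (by norm_num)

/-- **ELECTRON-DOPED cap, `β' ≥ 5/4`, EVERY `U ≤ 8`**: `e_{Φ(1,−1/4,U)}(ω) ≤ 0.0052677959 + U/8` for every torus limit of the canonical class at
`(1, −1/4, U, 9/8, β')` along `Ls` with `4 ∣ Ls j` eventually. Strength = C2(cert_c2sector_tp1o4_3x3_b5o4_j273931) ∧ kernel theorems.
[cite: LiebWuPhysicaA2003, §1 eq. (3)] [cite: Israel1979, Thm. I.3.4] -/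
theorem thermal_n9o8_tpm1o4_upper_b5o4_PH_C2only_of_U_le (hC2 : cert_c2sector_tp1o4_3x3_b5o4_j273931) {U : ℝ} (hU8 : U ≤ 8)
    {β : ℝ} (hle : (5 / 4 : ℝ) ≤ β) {ω : InfVolFermionState 2} {Ls : ℕ → ℕ} (hLs : Tendsto Ls atTop atTop) (h4 : ∀ᶠ j in atTop, 4 ∣ Ls j)
    (h : ω.IsTorusLimitOfMixture (sectorGibbsCount (9 / 8)) (fun L => sectorGibbsWeightTT' β 1 (-1 / 4) U (9 / 8) L)
      (fun L => sectorGibbsVectorTT' 1 (-1 / 4) U (9 / 8) L) Ls) :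
    ω.meanEnergy (hubbardTTPrimeFermionInteraction 1 (-1 / 4) U) 1 ≤ (0.0052677959 : ℝ) + U * (1 / 8) :=
  thermal_n9o8_tpm1o4_upper_of_image_cap_U
    (fun _ _ hLs' h' => image_n7o8_tp1o4_upper_b5o4_C2only_of_U_le hC2 hU8 hle hLs' h') hLs h4 h

/-- **ELECTRON-DOPED WINDOW, `β' ≥ 5/4`, EVERY `0 ≤ U ≤ 8`**: `e ∈ [−1.7034878090 + U/8, 0.0052677959 + U/8]`. Strength (upper edge) =
C2(cert_c2sector_tp1o4_3x3_b5o4_j273931) ∧ kernel theorems; lower edge kernel. [cite: LiebWuPhysicaA2003, §1 eq. (3)] [cite: Ruelle1969, §3.4] -/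
theorem thermal_n9o8_tpm1o4_window_b5o4_PH_C2only_of_U_le (hC2 : cert_c2sector_tp1o4_3x3_b5o4_j273931) {U : ℝ} (hU0 : 0 ≤ U) (hU8 : U ≤ 8)
    {β : ℝ} (hle : (5 / 4 : ℝ) ≤ β) {ω : InfVolFermionState 2} {Ls : ℕ → ℕ} (hLs : Tendsto Ls atTop atTop) (h4 : ∀ᶠ j in atTop, 4 ∣ Ls j)
    (h : ω.IsTorusLimitOfMixture (sectorGibbsCount (9 / 8)) (fun L => sectorGibbsWeightTT' β 1 (-1 / 4) U (9 / 8) L)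
      (fun L => sectorGibbsVectorTT' 1 (-1 / 4) U (9 / 8) L) Ls) :
    ω.meanEnergy (hubbardTTPrimeFermionInteraction 1 (-1 / 4) U) 1 ∈
      Set.Icc ((-1.7034878090 : ℝ) + U * (1 / 8)) ((0.0052677959 : ℝ) + U * (1 / 8)) :=
  ⟨thermal_n9o8_tpm1o4_lower_U hU0 hLs h, thermal_n9o8_tpm1o4_upper_b5o4_PH_C2only_of_U_le hC2 hU8 hle hLs h4 h⟩

/-- **Image-point C2-ONLY cap at `β = 3/2`, EVERY `U ≤ 8`, every colder `β' ≥ 3/2`** (hole side `(1, 1/4, U, 7/8)`, every `Ls'`): `e ≤ -0.0688291288`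
(`= (1.371 − W)/β` outward, `W = 810474041465/549755813888` of `c2Check_tp1o4_3x3_b3o2_j273931`; the sidecar sits at `U₀ = 8` and reads DOWN in `U` —
hubbard-downfold-unc-1's `…le_of_c2Check_infT_seven_eighths_of_le_U`; colder by `…le_of_forall_at_hotter_allTori`). Strength = C2(cert_c2sector_tp1o4_3x3_b3o2_j273931) ∧ kernel theorems.
[cite: Israel1979, Thm. I.3.4] [cite: CoverThomas2006, Theorem 11.1.3] [cite: Ruelle1969, §2.5–2.6] -/
theorem image_n7o8_tp1o4_upper_b3o2_C2only_of_U_le (hC2 : cert_c2sector_tp1o4_3x3_b3o2_j273931) {U : ℝ} (hU8 : U ≤ 8)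
    {β : ℝ} (hle : (3 / 2 : ℝ) ≤ β) {ω : InfVolFermionState 2} {Ls : ℕ → ℕ} (hLs : Tendsto Ls atTop atTop)
    (h : ω.IsTorusLimitOfMixture (sectorGibbsCount (7 / 8)) (fun L => sectorGibbsWeightTT' β 1 (1 / 4) U (7 / 8) L)
      (fun L => sectorGibbsVectorTT' 1 (1 / 4) U (7 / 8) L) Ls) :
    ω.meanEnergy (hubbardTTPrimeFermionInteraction 1 (1 / 4) U) 1 ≤ (-0.0688291288 : ℝ) := by
  refine IsTorusLimitOfMixture.meanEnergy_hubbardTTPrime_le_of_forall_at_hotter_allTori (t := 1) (t' := (1 / 4)) (U := U)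
    (n := 7 / 8) (by norm_num) (by norm_num) (β₁ := (3 / 2 : ℝ)) (by norm_num) hle (fun ω₁ Ls₁ hLs₁ h₁ => ?_) hLs h
  have hk := h₁.meanEnergy_hubbardTTPrime_le_of_c2Check_infT_seven_eighths_of_le_U (U₀ := 8) hU8 hLs₁ (by norm_num)
    (a := 3) (b := 3) (by norm_num) (by norm_num) c2Check_tp1o4_3x3_b3o2_j273931 (by norm_num) hC2
  exact hk.trans (by norm_num)

/-- **ELECTRON-DOPED cap, `β' ≥ 3/2`, EVERY `U ≤ 8`**: `e_{Φ(1,−1/4,U)}(ω) ≤ -0.0688291288 + U/8` for every torus limit of the canonical class at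
`(1, −1/4, U, 9/8, β')` along `Ls` with `4 ∣ Ls j` eventually. Strength = C2(cert_c2sector_tp1o4_3x3_b3o2_j273931) ∧ kernel theorems.
[cite: LiebWuPhysicaA2003, §1 eq. (3)] [cite: Israel1979, Thm. I.3.4] -/
theorem thermal_n9o8_tpm1o4_upper_b3o2_PH_C2only_of_U_le (hC2 : cert_c2sector_tp1o4_3x3_b3o2_j273931) {U : ℝ} (hU8 : U ≤ 8)
    {β : ℝ} (hle : (3 / 2 : ℝ) ≤ β) {ω : InfVolFermionState 2} {Ls : ℕ → ℕ} (hLs : Tendsto Ls atTop atTop) (h4 : ∀ᶠ j in atTop, 4 ∣ Ls j)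
    (h : ω.IsTorusLimitOfMixture (sectorGibbsCount (9 / 8)) (fun L => sectorGibbsWeightTT' β 1 (-1 / 4) U (9 / 8) L)
      (fun L => sectorGibbsVectorTT' 1 (-1 / 4) U (9 / 8) L) Ls) :
    ω.meanEnergy (hubbardTTPrimeFermionInteraction 1 (-1 / 4) U) 1 ≤ (-0.0688291288 : ℝ) + U * (1 / 8) :=
  thermal_n9o8_tpm1o4_upper_of_image_cap_U
    (fun _ _ hLs' h' => image_n7o8_tp1o4_upper_b3o2_C2only_of_U_le hC2 hU8 hle hLs' h') hLs h4 h

/-- **ELECTRON-DOPED WINDOW, `β' ≥ 3/2`, EVERY `0 ≤ U ≤ 8`**: `e ∈ [−1.7034878090 + U/8, -0.0688291288 + U/8]`. Strength (upper edge) =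
C2(cert_c2sector_tp1o4_3x3_b3o2_j273931) ∧ kernel theorems; lower edge kernel. [cite: LiebWuPhysicaA2003, §1 eq. (3)] [cite: Ruelle1969, §3.4] -/
theorem thermal_n9o8_tpm1o4_window_b3o2_PH_C2only_of_U_le (hC2 : cert_c2sector_tp1o4_3x3_b3o2_j273931) {U : ℝ} (hU0 : 0 ≤ U) (hU8 : U ≤ 8)
    {β : ℝ} (hle : (3 / 2 : ℝ) ≤ β) {ω : InfVolFermionState 2} {Ls : ℕ → ℕ} (hLs : Tendsto Ls atTop atTop) (h4 : ∀ᶠ j in atTop, 4 ∣ Ls j)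
    (h : ω.IsTorusLimitOfMixture (sectorGibbsCount (9 / 8)) (fun L => sectorGibbsWeightTT' β 1 (-1 / 4) U (9 / 8) L)
      (fun L => sectorGibbsVectorTT' 1 (-1 / 4) U (9 / 8) L) Ls) :
    ω.meanEnergy (hubbardTTPrimeFermionInteraction 1 (-1 / 4) U) 1 ∈
      Set.Icc ((-1.7034878090 : ℝ) + U * (1 / 8)) ((-0.0688291288 : ℝ) + U * (1 / 8)) :=
  ⟨thermal_n9o8_tpm1o4_lower_U hU0 hLs h, thermal_n9o8_tpm1o4_upper_b3o2_PH_C2only_of_U_le hC2 hU8 hle hLs h4 h⟩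

/-- **Image-point C2-ONLY cap at `β = 2`, EVERY `U ≤ 8`, every colder `β' ≥ 2`** (hole side `(1, 1/4, U, 7/8)`, every `Ls'`): `e ≤ -0.1701056955`
(`= (1.371 − W)/β` outward, `W = 940748411101/549755813888` of `c2Check_tp1o4_3x3_b2_j273931`; the sidecar sits at `U₀ = 8` and reads DOWN in `U` —
hubbard-downfold-unc-1's `…le_of_c2Check_infT_seven_eighths_of_le_U`; colder by `…le_of_forall_at_hotter_allTori`). Strength = C2(cert_c2sector_tp1o4_3x3_b2_j273931) ∧ kernel theorems.
[cite: Israel1979, Thm. I.3.4] [cite: CoverThomas2006, Theorem 11.1.3] [cite: Ruelle1969, §2.5–2.6] -/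
theorem image_n7o8_tp1o4_upper_b2_C2only_of_U_le (hC2 : cert_c2sector_tp1o4_3x3_b2_j273931) {U : ℝ} (hU8 : U ≤ 8)
    {β : ℝ} (hle : (2 : ℝ) ≤ β) {ω : InfVolFermionState 2} {Ls : ℕ → ℕ} (hLs : Tendsto Ls atTop atTop)
    (h : ω.IsTorusLimitOfMixture (sectorGibbsCount (7 / 8)) (fun L => sectorGibbsWeightTT' β 1 (1 / 4) U (7 / 8) L)
      (fun L => sectorGibbsVectorTT' 1 (1 / 4) U (7 / 8) L) Ls) :
    ω.meanEnergy (hubbardTTPrimeFermionInteraction 1 (1 / 4) U) 1 ≤ (-0.1701056955 : ℝ) := by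
  refine IsTorusLimitOfMixture.meanEnergy_hubbardTTPrime_le_of_forall_at_hotter_allTori (t := 1) (t' := (1 / 4)) (U := U)
    (n := 7 / 8) (by norm_num) (by norm_num) (β₁ := (2 : ℝ)) (by norm_num) hle (fun ω₁ Ls₁ hLs₁ h₁ => ?_) hLs h
  have hk := h₁.meanEnergy_hubbardTTPrime_le_of_c2Check_infT_seven_eighths_of_le_U (U₀ := 8) hU8 hLs₁ (by norm_num)
    (a := 3) (b := 3) (by norm_num) (by norm_num) c2Check_tp1o4_3x3_b2_j273931 (by norm_num) hC2
  exact hk.trans (by norm_num)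

/-- **ELECTRON-DOPED cap, `β' ≥ 2`, EVERY `U ≤ 8`**: `e_{Φ(1,−1/4,U)}(ω) ≤ -0.1701056955 + U/8` for every torus limit of the canonical class at
`(1, −1/4, U, 9/8, β')` along `Ls` with `4 ∣ Ls j` eventually. Strength = C2(cert_c2sector_tp1o4_3x3_b2_j273931) ∧ kernel theorems.
[cite: LiebWuPhysicaA2003, §1 eq. (3)] [cite: Israel1979, Thm. I.3.4] -/
theorem thermal_n9o8_tpm1o4_upper_b2_PH_C2only_of_U_le (hC2 : cert_c2sector_tp1o4_3x3_b2_j273931) {U : ℝ} (hU8 : U ≤ 8)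
    {β : ℝ} (hle : (2 : ℝ) ≤ β) {ω : InfVolFermionState 2} {Ls : ℕ → ℕ} (hLs : Tendsto Ls atTop atTop) (h4 : ∀ᶠ j in atTop, 4 ∣ Ls j)
    (h : ω.IsTorusLimitOfMixture (sectorGibbsCount (9 / 8)) (fun L => sectorGibbsWeightTT' β 1 (-1 / 4) U (9 / 8) L)
      (fun L => sectorGibbsVectorTT' 1 (-1 / 4) U (9 / 8) L) Ls) :
    ω.meanEnergy (hubbardTTPrimeFermionInteraction 1 (-1 / 4) U) 1 ≤ (-0.1701056955 : ℝ) + U * (1 / 8) :=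
  thermal_n9o8_tpm1o4_upper_of_image_cap_U
    (fun _ _ hLs' h' => image_n7o8_tp1o4_upper_b2_C2only_of_U_le hC2 hU8 hle hLs' h') hLs h4 h

/-- **ELECTRON-DOPED WINDOW, `β' ≥ 2`, EVERY `0 ≤ U ≤ 8`**: `e ∈ [−1.7034878090 + U/8, -0.1701056955 + U/8]`. Strength (upper edge) =
C2(cert_c2sector_tp1o4_3x3_b2_j273931) ∧ kernel theorems; lower edge kernel. [cite: LiebWuPhysicaA2003, §1 eq. (3)] [cite: Ruelle1969, §3.4] -/
theorem thermal_n9o8_tpm1o4_window_b2_PH_C2only_of_U_le (hC2 : cert_c2sector_tp1o4_3x3_b2_j273931) {U : ℝ} (hU0 : 0 ≤ U) (hU8 : U ≤ 8)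
    {β : ℝ} (hle : (2 : ℝ) ≤ β) {ω : InfVolFermionState 2} {Ls : ℕ → ℕ} (hLs : Tendsto Ls atTop atTop) (h4 : ∀ᶠ j in atTop, 4 ∣ Ls j)
    (h : ω.IsTorusLimitOfMixture (sectorGibbsCount (9 / 8)) (fun L => sectorGibbsWeightTT' β 1 (-1 / 4) U (9 / 8) L)
      (fun L => sectorGibbsVectorTT' 1 (-1 / 4) U (9 / 8) L) Ls) :
    ω.meanEnergy (hubbardTTPrimeFermionInteraction 1 (-1 / 4) U) 1 ∈
      Set.Icc ((-1.7034878090 : ℝ) + U * (1 / 8)) ((-0.1701056955 : ℝ) + U * (1 / 8)) :=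
  ⟨thermal_n9o8_tpm1o4_lower_U hU0 hLs h, thermal_n9o8_tpm1o4_upper_b2_PH_C2only_of_U_le hC2 hU8 hle hLs h4 h⟩

/-- **Image-point C2-ONLY cap at `β = 3`, EVERY `U ≤ 8`, every colder `β' ≥ 3`** (hole side `(1, 1/4, U, 7/8)`, every `Ls'`): `e ≤ -0.2862113870`
(`= (1.371 − W)/β` outward, `W = 1225754342927/549755813888` of `c2Check_tp1o4_3x3_b3_j273931`; the sidecar sits at `U₀ = 8` and reads DOWN in `U` —
hubbard-downfold-unc-1's `…le_of_c2Check_infT_seven_eighths_of_le_U`; colder by `…le_of_forall_at_hotter_allTori`). Strength = C2(cert_c2sector_tp1o4_3x3_b3_j273931) ∧ kernel theorems.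
[cite: Israel1979, Thm. I.3.4] [cite: CoverThomas2006, Theorem 11.1.3] [cite: Ruelle1969, §2.5–2.6] -/
theorem image_n7o8_tp1o4_upper_b3_C2only_of_U_le (hC2 : cert_c2sector_tp1o4_3x3_b3_j273931) {U : ℝ} (hU8 : U ≤ 8)
    {β : ℝ} (hle : (3 : ℝ) ≤ β) {ω : InfVolFermionState 2} {Ls : ℕ → ℕ} (hLs : Tendsto Ls atTop atTop)
    (h : ω.IsTorusLimitOfMixture (sectorGibbsCount (7 / 8)) (fun L => sectorGibbsWeightTT' β 1 (1 / 4) U (7 / 8) L)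
      (fun L => sectorGibbsVectorTT' 1 (1 / 4) U (7 / 8) L) Ls) :
    ω.meanEnergy (hubbardTTPrimeFermionInteraction 1 (1 / 4) U) 1 ≤ (-0.2862113870 : ℝ) := by
  refine IsTorusLimitOfMixture.meanEnergy_hubbardTTPrime_le_of_forall_at_hotter_allTori (t := 1) (t' := (1 / 4)) (U := U)
    (n := 7 / 8) (by norm_num) (by norm_num) (β₁ := (3 : ℝ)) (by norm_num) hle (fun ω₁ Ls₁ hLs₁ h₁ => ?_) hLs h
  have hk := h₁.meanEnergy_hubbardTTPrime_le_of_c2Check_infT_seven_eighths_of_le_U (U₀ := 8) hU8 hLs₁ (by norm_num)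
    (a := 3) (b := 3) (by norm_num) (by norm_num) c2Check_tp1o4_3x3_b3_j273931 (by norm_num) hC2
  exact hk.trans (by norm_num)

/-- **ELECTRON-DOPED cap, `β' ≥ 3`, EVERY `U ≤ 8`**: `e_{Φ(1,−1/4,U)}(ω) ≤ -0.2862113870 + U/8` for every torus limit of the canonical class at
`(1, −1/4, U, 9/8, β')` along `Ls` with `4 ∣ Ls j` eventually. Strength = C2(cert_c2sector_tp1o4_3x3_b3_j273931) ∧ kernel theorems.
[cite: LiebWuPhysicaA2003, §1 eq. (3)] [cite: Israel1979, Thm. I.3.4] -/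
theorem thermal_n9o8_tpm1o4_upper_b3_PH_C2only_of_U_le (hC2 : cert_c2sector_tp1o4_3x3_b3_j273931) {U : ℝ} (hU8 : U ≤ 8)
    {β : ℝ} (hle : (3 : ℝ) ≤ β) {ω : InfVolFermionState 2} {Ls : ℕ → ℕ} (hLs : Tendsto Ls atTop atTop) (h4 : ∀ᶠ j in atTop, 4 ∣ Ls j)
    (h : ω.IsTorusLimitOfMixture (sectorGibbsCount (9 / 8)) (fun L => sectorGibbsWeightTT' β 1 (-1 / 4) U (9 / 8) L)
      (fun L => sectorGibbsVectorTT' 1 (-1 / 4) U (9 / 8) L) Ls) :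
    ω.meanEnergy (hubbardTTPrimeFermionInteraction 1 (-1 / 4) U) 1 ≤ (-0.2862113870 : ℝ) + U * (1 / 8) :=
  thermal_n9o8_tpm1o4_upper_of_image_cap_U
    (fun _ _ hLs' h' => image_n7o8_tp1o4_upper_b3_C2only_of_U_le hC2 hU8 hle hLs' h') hLs h4 h

/-- **ELECTRON-DOPED WINDOW, `β' ≥ 3`, EVERY `0 ≤ U ≤ 8`**: `e ∈ [−1.7034878090 + U/8, -0.2862113870 + U/8]`. Strength (upper edge) =
C2(cert_c2sector_tp1o4_3x3_b3_j273931) ∧ kernel theorems; lower edge kernel. [cite: LiebWuPhysicaA2003, §1 eq. (3)] [cite: Ruelle1969, §3.4] -/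
theorem thermal_n9o8_tpm1o4_window_b3_PH_C2only_of_U_le (hC2 : cert_c2sector_tp1o4_3x3_b3_j273931) {U : ℝ} (hU0 : 0 ≤ U) (hU8 : U ≤ 8)
    {β : ℝ} (hle : (3 : ℝ) ≤ β) {ω : InfVolFermionState 2} {Ls : ℕ → ℕ} (hLs : Tendsto Ls atTop atTop) (h4 : ∀ᶠ j in atTop, 4 ∣ Ls j)
    (h : ω.IsTorusLimitOfMixture (sectorGibbsCount (9 / 8)) (fun L => sectorGibbsWeightTT' β 1 (-1 / 4) U (9 / 8) L)
      (fun L => sectorGibbsVectorTT' 1 (-1 / 4) U (9 / 8) L) Ls) :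
    ω.meanEnergy (hubbardTTPrimeFermionInteraction 1 (-1 / 4) U) 1 ∈
      Set.Icc ((-1.7034878090 : ℝ) + U * (1 / 8)) ((-0.2862113870 : ℝ) + U * (1 / 8)) :=
  ⟨thermal_n9o8_tpm1o4_lower_U hU0 hLs h, thermal_n9o8_tpm1o4_upper_b3_PH_C2only_of_U_le hC2 hU8 hle hLs h4 h⟩

end Summit.Ventures.CertifiedManyBodySolver.Certificates

end
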